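import Summits.MatrixMultiplication.MatrixMultiplication.Theses.SnSubsetDichotomy
import Summits.MatrixMultiplication.MatrixMultiplication.Theorems.SnSubsetDichotomyNegativeSideResistance

/-!
# Strategist sketch — crux `SnSubsetDichotomy.ThresholdSubsetTriples` (stmt-MatrixMultiplication-10882)

Typed statements behind `STRATEGY-CENSUS.md` (crux-strategist seat
`planner-cstrat-stmt-MatrixMultiplication-10882-0`, 2026-08-16).  Everything here is sorry-free; nothing
here is a line or a stub.  Sections follow the census headings.

* §0  `ThresholdAt`, antitonicity (re-derived; `Disproof.lean` has the same, but is not imported).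
* §Strengthen  `ThresholdAllLargeN`, `ThresholdSubgroupTriples`, `PolynomialThreshold` — three rigid
  forms `S⁺` with `S⁺ → X` proved (so each WOULD feed `closes`); the census says why the added rigidity
  buys nothing.
* §Decomposition  the scale split `SubexpSqrtFamily ∧ ScaleHalving → X` (proved glue), recorded to show
  the split is typed — and why `ScaleHalving` is the crux in disguise.
* §Transfer  the border / combinatorial-degeneration relaxation `PotentialGraded` ("every TPP violation
  has positive potential drop"): `TPP → PotentialGraded`; level sets of the potentials are honest TPP
  triples (`tpp_levelSets`, the pigeonhole repair); and the NO-GO `potentialGraded_subgroup_iff`: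
  for SUBGROUP triples the relaxation is void (averaging over the right-translation orbit of a
  violation).
-/

namespace Summit.MatrixMultiplication.MatrixMultiplication.Cruxes.ThresholdSubsetTriples.Strategist

open scoped BigOperators Classical
open Summit.MatrixMultiplication.MatrixMultiplication.Theses.SnSubsetDichotomy
open Literature.Combinatorics.Additive

set_option linter.dupNamespace false
set_option autoImplicit false

/-! ## §0 Scales -/

/-- The volume condition of the crux at scale `c`. -/
def Beats (c : ℝ) (n : ℕ) (S T U : Finset (Equiv.Perm (Fin n))) : Prop :=
  (n.factorial : ℝ) ^ ((3 : ℝ) / 2) * Real.exp (-(c * Real.sqrt (n : ℝ))) <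
    ((S.card * T.card * U.card : ℕ) : ℝ)

/-- The crux at one fixed scale `c` (cofinally in `n`). -/
def ThresholdAt (c : ℝ) : Prop :=
  ∀ n₀ : ℕ, ∃ n ≥ n₀, ∃ S T U : Finset (Equiv.Perm (Fin n)),
    TripleProductProperty S T U ∧ Beats c n S T U

theorem thresholdSubsetTriples_iff : ThresholdSubsetTriples ↔ ∀ c : ℝ, 0 < c → ThresholdAt c :=
  Iff.rfl

theorem Beats.mono {c c' : ℝ} (h : c ≤ c') {n : ℕ} {S T U : Finset (Equiv.Perm (Fin n))}
    (hB : Beats c n S T U) : Beats c' n S T U := by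
  unfold Beats at hB ⊢
  refine lt_of_le_of_lt ?_ hB
  have hs : 0 ≤ Real.sqrt (n : ℝ) := Real.sqrt_nonneg _
  gcongr

theorem ThresholdAt.anti {c c' : ℝ} (h : c ≤ c') (hc : ThresholdAt c) : ThresholdAt c' := by
  intro n₀
  obtain ⟨n, hn, S, T, U, hT, hB⟩ := hc n₀
  exact ⟨n, hn, S, T, U, hT, hB.mono h⟩

/-! ## §Strengthen — rigid forms `S⁺ → X` -/

/-- `S⁺₁`: threshold triples at ALL large `n` (not just cofinally). -/
def ThresholdAllLargeN : Prop :=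
  ∀ c : ℝ, 0 < c → ∃ n₀ : ℕ, ∀ n ≥ n₀, ∃ S T U : Finset (Equiv.Perm (Fin n)),
    TripleProductProperty S T U ∧ Beats c n S T U

theorem thresholdSubsetTriples_of_allLargeN (h : ThresholdAllLargeN) : ThresholdSubsetTriples := by
  intro c hc n₀
  obtain ⟨n₁, h₁⟩ := h c hc
  obtain ⟨S, T, U, hT, hB⟩ := h₁ (max n₀ n₁) (le_max_right _ _)
  exact ⟨max n₀ n₁, le_max_left _ _, S, T, U, hT, hB⟩

/-- A subgroup of `S_n` as a `Finset`. -/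
noncomputable abbrev carrierSet {n : ℕ} (H : Subgroup (Equiv.Perm (Fin n))) :
    Finset (Equiv.Perm (Fin n)) :=
  Finset.univ.filter (· ∈ H)

/-- `S⁺₂`: threshold triples of SUBGROUPS (= the deciding side of the sibling route
`SnThresholdCensus`, i.e. `¬ NoThresholdSubgroupTriple`). -/
def ThresholdSubgroupTriples : Prop :=
  ∀ c : ℝ, 0 < c → ∀ n₀ : ℕ, ∃ n ≥ n₀, ∃ H₁ H₂ H₃ : Subgroup (Equiv.Perm (Fin n)),
    TripleProductProperty (carrierSet H₁) (carrierSet H₂) (carrierSet H₃) ∧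
      Beats c n (carrierSet H₁) (carrierSet H₂) (carrierSet H₃)

theorem thresholdSubsetTriples_of_subgroupTriples (h : ThresholdSubgroupTriples) :
    ThresholdSubsetTriples := by
  intro c hc n₀
  obtain ⟨n, hn, H₁, H₂, H₃, hT, hB⟩ := h c hc n₀
  exact ⟨n, hn, _, _, _, hT, hB⟩

/-- `S⁺₃`: ONE polynomial slack `n^{-C}` (the positive form of `¬ PolynomialSlack`, crux 8306). -/
def PolynomialThreshold : Prop :=
  ∃ C : ℝ, ∀ n₀ : ℕ, ∃ n ≥ n₀, ∃ S T U : Finset (Equiv.Perm (Fin n)),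
    TripleProductProperty S T U ∧
      (n.factorial : ℝ) ^ ((3 : ℝ) / 2) < ((S.card * T.card * U.card : ℕ) : ℝ) * (n : ℝ) ^ C

theorem not_polynomialSlack_of_polynomialThreshold (h : PolynomialThreshold) : ¬ PolynomialSlack := by
  rintro hP
  obtain ⟨C, hC⟩ := h
  obtain ⟨n₀, hn₀⟩ := hP C
  obtain ⟨n, hn, S, T, U, hT, hlt⟩ := hC n₀
  exact absurd (hn₀ n hn S T U hT) (not_le.2 hlt)

/-- `S⁺₃ → X`, through the landed edge `¬ PolynomialSlack → X` of `NegativeSideResistance`. -/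
theorem thresholdSubsetTriples_of_polynomialThreshold (h : PolynomialThreshold) :
    ThresholdSubsetTriples :=
  Summit.MatrixMultiplication.MatrixMultiplication.Theorems.NegativeSideResistance.thresholdSubsetTriples_of_not_polynomialSlack
    (not_polynomialSlack_of_polynomialThreshold h)

/-! ## §Decomposition — the scale split -/

/-- `Sub₁`: SOME `e^{-O(√n)}` family — the BCCGU 2017 §5 calibration milestone ("sets of size
`n!^{1/2}/e^{O(√n)}` must be ruled out"); strictly WEAKER than `X`; open, and already unknown in every
group. -/
def SubexpSqrtFamily : Prop := ∃ c : ℝ, 0 < c ∧ ThresholdAt c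

/-- `Sub₂`: scale halving — an amplification step.  No mechanism is known (products in `S_n` lose
multinomials: the Young barrier); under `¬X ∧ Sub₁` it is FALSE, under `¬Sub₁` it is VACUOUS, so it
carries exactly the content of `X` given `Sub₁`: the census files it as the crux in disguise. -/
def ScaleHalving : Prop := ∀ c : ℝ, 0 < c → ThresholdAt c → ThresholdAt (c / 2)

/-- The split is typed and its glue is real: `Sub₁ → Sub₂ → X`. -/
theorem thresholdSubsetTriples_of_subs (h₁ : SubexpSqrtFamily) (h₂ : ScaleHalving) :
    ThresholdSubsetTriples := by
  obtain ⟨c₀, hc₀, h₀⟩ := h₁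
  have hk : ∀ k : ℕ, ThresholdAt (c₀ / 2 ^ k) := by
    intro k
    induction k with
    | zero => simpa using h₀
    | succ k ih =>
      have h := h₂ (c₀ / 2 ^ k) (by positivity) ih
      rw [pow_succ, ← div_div]
      exact h
  intro c hc n₀
  obtain ⟨k, hk'⟩ := exists_pow_lt_of_lt_one (div_pos hc hc₀) (by norm_num : (1 / 2 : ℝ) < 1)
  have hle : c₀ / 2 ^ k ≤ c := by
    have h1 : c₀ * (1 / 2) ^ k < c₀ * (c / c₀) := mul_lt_mul_of_pos_left hk' hc₀
    have h2 : c₀ * (c / c₀) = c := by field_simp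
    have h3 : c₀ * (1 / 2) ^ k = c₀ / 2 ^ k := by rw [one_div_pow, mul_one_div]
    rw [h2, h3] at h1
    exact h1.le
  exact (ThresholdAt.anti hle (hk k)) n₀

/-! ## §Transfer — the border / combinatorial-degeneration relaxation -/

section Border

variable {G : Type*} [Group G]

/-- **Potential-graded TPP** (the combinatorial-degeneration = border relaxation of the TPP in the
group basis): there are integer potentials `p, q, r` on the three sets such that every solution of the
TPP equation `s s'⁻¹ (t t'⁻¹) (u u'⁻¹) = 1` is either trivial or has a positive potential drop
`p s + q t + r u < p s' + q t' + r u'`.  With the pairwise (two-set) conditions this is exactly a set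
of monomial weights degenerating the restricted group tensor to `⟨|S|,|T|,|U|⟩` (Bürgisser–Clausen–
Shokrollahi Def. 15.29), hence it feeds a BORDER-rank version of CKSU 2005 Thm 1.8 — the finite-group
shadow of the border-separating functions of Blasiak–Cohn–Grochow–Pratt–Umans (arXiv:2410.14905,
Def. 2.5).  `TPP` is the case `p = q = r = 0`. -/
def PotentialGraded (S T U : Finset G) : Prop :=
  ∃ p q r : G → ℤ, ∀ s ∈ S, ∀ s' ∈ S, ∀ t ∈ T, ∀ t' ∈ T, ∀ u ∈ U, ∀ u' ∈ U,
    s * s'⁻¹ * (t * t'⁻¹) * (u * u'⁻¹) = 1 →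
      (s = s' ∧ t = t' ∧ u = u') ∨ p s + q t + r u < p s' + q t' + r u'

theorem potentialGraded_of_tpp {S T U : Finset G} (h : TripleProductProperty S T U) :
    PotentialGraded S T U :=
  ⟨0, 0, 0, fun s hs s' hs' t ht t' ht' u hu u' hu' e => Or.inl (h s hs s' hs' t ht t' ht' u hu u' hu' e)⟩

/-- **Pigeonhole repair**: level sets of the potentials form an honest TPP triple.  Hence a
potential-graded triple whose potentials take `L_S, L_T, L_U` values contains a TPP sub-triple of
volume `≥ |S||T||U|/(L_S L_T L_U)`: the relaxation has teeth only with MANY levels (`e^{Ω(√n)}`). -/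
theorem tpp_levelSets {S T U : Finset G} {p q r : G → ℤ}
    (h : ∀ s ∈ S, ∀ s' ∈ S, ∀ t ∈ T, ∀ t' ∈ T, ∀ u ∈ U, ∀ u' ∈ U,
      s * s'⁻¹ * (t * t'⁻¹) * (u * u'⁻¹) = 1 →
        (s = s' ∧ t = t' ∧ u = u') ∨ p s + q t + r u < p s' + q t' + r u')
    (i j k : ℤ) :
    TripleProductProperty (S.filter (fun s => p s = i)) (T.filter (fun t => q t = j))
      (U.filter (fun u => r u = k)) := by
  intro s hs s' hs' t ht t' ht' u hu u' hu' e
  simp only [Finset.mem_filter] at hs hs' ht ht' hu hu'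
  rcases h s hs.1 s' hs'.1 t ht.1 t' ht'.1 u hu.1 u' hu'.1 e with h1 | h2
  · exact h1
  · exfalso
    rw [hs.2, hs'.2, ht.2, ht'.2, hu.2, hu'.2] at h2
    exact lt_irrefl _ h2

/-- Averaging lemma: if `f` and `g` have the same sum over a non-empty `F` and
`f i + A < g i + B` termwise, then `A < B`. -/
theorem lt_of_sum_eq_of_forall_lt {ι : Type*} (F : Finset ι) (hF : F.Nonempty) (f g : ι → ℤ)
    (A B : ℤ) (hfg : ∑ i ∈ F, f i = ∑ i ∈ F, g i) (h : ∀ i ∈ F, f i + A < g i + B) : A < B := by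
  have hlt : ∑ i ∈ F, (f i + A) < ∑ i ∈ F, (g i + B) := Finset.sum_lt_sum_of_nonempty hF h
  rw [Finset.sum_add_distrib, Finset.sum_add_distrib, Finset.sum_const, Finset.sum_const, hfg,
    nsmul_eq_mul, nsmul_eq_mul] at hlt
  have hcard : (0 : ℤ) < F.card := by exact_mod_cast hF.card_pos
  have h2 : (F.card : ℤ) * A < (F.card : ℤ) * B := by linarith
  exact lt_of_mul_lt_mul_left h2 hcard.le

/-- Right translation inside a subgroup does not change a sum over the subgroup. -/
theorem sum_mul_left_eq {H : Subgroup G} (F : Finset G) (hF : ∀ x, x ∈ F ↔ x ∈ H) (p : G → ℤ)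
    {s s' : G} (hs : s ∈ H) (hs' : s' ∈ H) :
    ∑ k ∈ F, p (s * k) = ∑ k ∈ F, p (s' * k) := by
  refine Finset.sum_nbij' (fun k => s'⁻¹ * (s * k)) (fun k => s⁻¹ * (s' * k)) ?_ ?_ ?_ ?_ ?_
  · intro k hk
    exact (hF _).2 (H.mul_mem (H.inv_mem hs') (H.mul_mem hs ((hF k).1 hk)))
  · intro k hk
    exact (hF _).2 (H.mul_mem (H.inv_mem hs) (H.mul_mem hs' ((hF k).1 hk)))
  · intro k _
    simp
  · intro k _
    simp
  · intro k _
    simp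

/-- **NO-GO: the border relaxation is void for SUBGROUP triples.**  If `S, T, U` are (the carriers
of) subgroups, `PotentialGraded S T U ↔ TripleProductProperty S T U`.  Proof: a violation
`(s,s',t,t',u,u')` generates the violations `(sk₁, s'k₁, tk₂, t'k₂, uk₃, u'k₃)` for all `kᵢ` in the
subgroups (same quotients); averaging the strict drop inequality over `k₁`, then `k₂`, then `k₃`
kills `p`, then `q`, then `r` and leaves `0 < 0`. -/
theorem potentialGraded_subgroup_iff (H₁ H₂ H₃ : Subgroup G) (S T U : Finset G)
    (hS : ∀ x, x ∈ S ↔ x ∈ H₁) (hT : ∀ x, x ∈ T ↔ x ∈ H₂) (hU : ∀ x, x ∈ U ↔ x ∈ H₃) :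
    PotentialGraded S T U ↔ TripleProductProperty S T U := by
  refine ⟨fun hPG => ?_, potentialGraded_of_tpp⟩
  obtain ⟨p, q, r, h⟩ := hPG
  intro s hs s' hs' t ht t' ht' u hu u' hu' e
  by_contra hne
  have hS1 : (1 : G) ∈ S := (hS 1).2 H₁.one_mem
  have hT1 : (1 : G) ∈ T := (hT 1).2 H₂.one_mem
  have hU1 : (1 : G) ∈ U := (hU 1).2 H₃.one_mem
  -- the translated violations
  have fam : ∀ k₁ ∈ S, ∀ k₂ ∈ T, ∀ k₃ ∈ U,
      p (s * k₁) + q (t * k₂) + r (u * k₃) < p (s' * k₁) + q (t' * k₂) + r (u' * k₃) := by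
    intro k₁ hk₁ k₂ hk₂ k₃ hk₃
    have hk₁H := (hS k₁).1 hk₁
    have hk₂H := (hT k₂).1 hk₂
    have hk₃H := (hU k₃).1 hk₃
    have e' : s * k₁ * (s' * k₁)⁻¹ * (t * k₂ * (t' * k₂)⁻¹) * (u * k₃ * (u' * k₃)⁻¹) = 1 := by
      simpa [mul_inv_rev, mul_assoc, mul_inv_cancel_left] using e
    rcases h (s * k₁) ((hS _).2 (H₁.mul_mem ((hS s).1 hs) hk₁H))
        (s' * k₁) ((hS _).2 (H₁.mul_mem ((hS s').1 hs') hk₁H))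
        (t * k₂) ((hT _).2 (H₂.mul_mem ((hT t).1 ht) hk₂H))
        (t' * k₂) ((hT _).2 (H₂.mul_mem ((hT t').1 ht') hk₂H))
        (u * k₃) ((hU _).2 (H₃.mul_mem ((hU u).1 hu) hk₃H))
        (u' * k₃) ((hU _).2 (H₃.mul_mem ((hU u').1 hu') hk₃H)) e' with htriv | hlt
    · exact absurd ⟨mul_right_cancel htriv.1, mul_right_cancel htriv.2.1,
        mul_right_cancel htriv.2.2⟩ hne
    · exact hlt
  -- average over k₁ (k₂, k₃ free)
  have step1 : ∀ k₂ ∈ T, ∀ k₃ ∈ U,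
      q (t * k₂) + r (u * k₃) < q (t' * k₂) + r (u' * k₃) := by
    intro k₂ hk₂ k₃ hk₃
    refine lt_of_sum_eq_of_forall_lt S ⟨1, hS1⟩ (fun k => p (s * k)) (fun k => p (s' * k)) _ _
      (sum_mul_left_eq S hS p ((hS s).1 hs) ((hS s').1 hs')) ?_
    intro k₁ hk₁
    have := fam k₁ hk₁ k₂ hk₂ k₃ hk₃
    linarith
  -- average over k₂ (k₃ free)
  have step2 : ∀ k₃ ∈ U, r (u * k₃) < r (u' * k₃) := by
    intro k₃ hk₃
    refine lt_of_sum_eq_of_forall_lt T ⟨1, hT1⟩ (fun k => q (t * k)) (fun k => q (t' * k)) _ _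
      (sum_mul_left_eq T hT q ((hT t).1 ht) ((hT t').1 ht')) ?_
    intro k₂ hk₂
    have := step1 k₂ hk₂ k₃ hk₃
    linarith
  -- average over k₃: contradiction
  have step3 : (0 : ℤ) < 0 := by
    refine lt_of_sum_eq_of_forall_lt U ⟨1, hU1⟩ (fun k => r (u * k)) (fun k => r (u' * k)) 0 0
      (sum_mul_left_eq U hU r ((hU u).1 hu) ((hU u').1 hu')) ?_
    intro k₃ hk₃
    simpa using step2 k₃ hk₃
  exact lt_irrefl _ step3

end Border

end Summit.MatrixMultiplication.MatrixMultiplication.Cruxes.ThresholdSubsetTriples.Strategist
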